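import Summits.RiemannHypothesis.RiemannHypothesis.Theorems.WeilWindowFlowGronwallLeakageIffWeilPos
import HarnessLib
import Summits.RiemannHypothesis.RiemannHypothesis.Theorems.WeilRouteProps.WeilWindowFlow

/-!
# Transport laws for the window bottom are already RH (crux stmt-RiemannHypothesis-1037, route WeilWindowFlow)

Costume detector for transfer targets of the crux `X = GronwallLeakage` (Grönwall leakage law for
`ε = weilGroundEnergy`). The exponential / integrable-rate structure of `X` is decorative: `X` is
equivalent to the WEAKEST transport law — from every base window `b₀ > 0` there is SOME non-negative factor
`F b a` with `ε b * F b a ≤ ε a` for `b₀ ≤ b ≤ a` — and any such law implies the Riemann hypothesis outright,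
by the same transport of the PROVED coercive anchor (`weilQuadratic_coercive`, `ε ≥ 0` near `0⁺`) that the
route's deciding theorem `closes` performs (strictness of `ε` never needed).

* `riemannHypothesis_of_nonneg_transport` — a non-negative transport law from every base window ⟹ RH;
* `gronwallLeakage_iff_nonneg_transport` — `X ⟺` the weakest transport law (so every "explicit envelope",
  "ladder law" or "certificate with budget" of this shape is RH-strength, never easier than `X`);
* `riemannHypothesis_of_envelopeLeakage` — the instance in the shape of the crux-idea transfer target
  `PolyaEnvelopeLeakage` (`Cruxes/GronwallLeakage/SketchIdeator1.lean`): for ANY weight `Φ : ℝ → ℝ`, a law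
  `ε b * ((Φ a / Φ b) ^ 4 * exp (-(K₀ * (a - b)))) ≤ ε a` on `[b₀, ∞)` for every `b₀ > 0` ⟹ RH.

Axioms ⊆ {propext, Classical.choice, Quot.sound}.
-/

-- `Summit.RiemannHypothesis.RiemannHypothesis.…` repeats a namespace component by design (D-0017 layout).
set_option linter.dupNamespace false

noncomputable section

namespace Summit.RiemannHypothesis.RiemannHypothesis.Theorems.WeilWindowFlowGronwallLeakage

open Literature.NumberTheory.LFunctions
open Summit.RiemannHypothesis.RiemannHypothesis.Theorems.WeilRouteProps.WeilWindowFlow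

/-- **A transport law with a non-negative factor from every base window implies RH.** If for every
`b₀ > 0` there is `F` with `0 ≤ F b a` and `ε b * F b a ≤ ε a` whenever `b₀ ≤ b ≤ a`, then the Riemann
hypothesis holds: take `b₀ = a₀` from the coercive anchor (`ε a₀ ≥ 0`, indeed Weil positivity on every window
`a ≤ a₀`), transport `0 ≤ ε` to every `a ≥ a₀`, turn it into `WeilPositivityOn a`
(`weilGroundEnergy_nonneg_iff_holds`) and apply Yoshida's criterion
(`riemannHypothesis_iff_forall_weilPositivityOn`). Same argument as `WeilWindowFlow.closes`. [folklore] -/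
theorem riemannHypothesis_of_nonneg_transport
    (hT : ∀ b₀ : ℝ, 0 < b₀ → ∃ F : ℝ → ℝ → ℝ, ∀ b a : ℝ, b₀ ≤ b → b ≤ a →
      0 ≤ F b a ∧ weilGroundEnergy b * F b a ≤ weilGroundEnergy a) :
    _root_.RiemannHypothesis := by
  refine (_root_.Literature.NumberTheory.LFunctions.riemannHypothesis_iff_forall_weilPositivityOn).2 ?_
  obtain ⟨a₀, ha₀, hcoer⟩ := _root_.Literature.NumberTheory.LFunctions.weilQuadratic_coercive 0
  have hiff : ∀ {a : ℝ}, 0 < a → (0 ≤ weilGroundEnergy a ↔ WeilPositivityOn a) :=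
    _root_.Literature.NumberTheory.LFunctions.weilGroundEnergy_nonneg_iff_holds
  have hsmall : ∀ a : ℝ, 0 < a → a ≤ a₀ → WeilPositivityOn a := by
    intro a ha hle g hg hsupp
    have h := hcoer a ha hle g hg hsupp
    simpa using h
  obtain ⟨F, hF⟩ := hT a₀ ha₀
  intro a ha
  by_cases hle : a ≤ a₀
  · exact hsmall a ha hle
  · have hlt : a₀ ≤ a := le_of_lt (lt_of_not_ge hle)
    have h0 : 0 ≤ weilGroundEnergy a₀ := (hiff ha₀).2 (hsmall a₀ ha₀ le_rfl)
    obtain ⟨hF0, hle'⟩ := hF a₀ a le_rfl hlt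
    exact (hiff ha).1 (le_trans (mul_nonneg h0 hF0) hle')

/-- **The crux is the weakest transport law.** `GronwallLeakage` holds iff from every base window `b₀ > 0`
the bottom is transported upward by SOME non-negative factor: `→` with `F b a := exp (-(∫ x in b..a, C x))`;
`←` through RH (`riemannHypothesis_of_nonneg_transport` and `gronwallLeakage_iff_riemannHypothesis`). So no
transfer target of transport shape is easier than `X`. [folklore] -/
theorem gronwallLeakage_iff_nonneg_transport :
    GronwallLeakage ↔
      ∀ b₀ : ℝ, 0 < b₀ → ∃ F : ℝ → ℝ → ℝ, ∀ b a : ℝ, b₀ ≤ b → b ≤ a →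
        0 ≤ F b a ∧ weilGroundEnergy b * F b a ≤ weilGroundEnergy a := by
  constructor
  · rintro ⟨C, hC⟩ b₀ hb₀
    refine ⟨fun b a ↦ Real.exp (-(∫ x in b..a, C x)), fun b a hb hba ↦ ⟨(Real.exp_pos _).le, ?_⟩⟩
    exact (hC b a (hb₀.trans_le hb) hba).2
  · intro hT
    exact gronwallLeakage_iff_riemannHypothesis.2 (riemannHypothesis_of_nonneg_transport hT)

/-- **Envelope leakage laws imply RH**, for any weight `Φ : ℝ → ℝ` (no positivity of `Φ` is needed: the
factor `(Φ a / Φ b) ^ 4 * exp (-(K₀ * (a - b)))` is an even power times an exponential, hence non-negative).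
This is the shape of the transfer target `PolyaEnvelopeLeakage` of crux idea `polya-radical-frame`
(`Cruxes/GronwallLeakage/SketchIdeator1.lean`, `Φ` = Pólya's kernel). [folklore] -/
theorem riemannHypothesis_of_envelopeLeakage (Φ : ℝ → ℝ)
    (hP : ∀ b₀ : ℝ, 0 < b₀ → ∃ K₀ : ℝ, ∀ b a : ℝ, b₀ ≤ b → b ≤ a →
      weilGroundEnergy b * ((Φ a / Φ b) ^ 4 * Real.exp (-(K₀ * (a - b)))) ≤ weilGroundEnergy a) :
    _root_.RiemannHypothesis := by
  refine riemannHypothesis_of_nonneg_transport fun b₀ hb₀ ↦ ?_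
  obtain ⟨K₀, hK⟩ := hP b₀ hb₀
  refine ⟨fun b a ↦ (Φ a / Φ b) ^ 4 * Real.exp (-(K₀ * (a - b))), fun b a hb hba ↦ ⟨?_, hK b a hb hba⟩⟩
  have h4 : 0 ≤ (Φ a / Φ b) ^ 4 := by positivity
  exact mul_nonneg h4 (Real.exp_pos _).le

end Summit.RiemannHypothesis.RiemannHypothesis.Theorems.WeilWindowFlowGronwallLeakage

end
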